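import Mathlib
import HarnessLib
import Summits.HubbardSuperconductivity.HubbardSuperconductivity.Theorems.KLProgrammeKLRegimeSplitBundleV14
import Summits.HubbardSuperconductivity.HubbardSuperconductivity.Theorems.KLProgrammeKLRegimeSplitEngineV10
import Summits.HubbardSuperconductivity.HubbardSuperconductivity.Theorems.KLProgrammeKLRegimeSplitFrameDegreeGuard

/-!
# Route `KLProgramme` — crux K3 `KLRegimeTwoPointLimit` (stmt-HubbardSuperconductivity-19937): the GEN-6 bundle `klPredsV15`
# (cell gate-hubbard-kl, seat p2 g9 = bundle typist; plan g14 RULING (R12) STATUS l.2049, GO l.2058, T1d l.2070, FREEZE (R16) l.2078, 2026-08-27)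

Δ25 / F2 (p1b g7 `SCALE0-TWOLEG-EXPORTS.md`, evidence #25 on 19918; ref-4 g9 §86 CONFIRM; kl-ref g37 §87; J g12 (R6-1) pin): V14's (E3c) clause
`FrameLipschitzFnT hist … K n = ∀ K', FrameOK … K' → (∀ j < n, hist K' j) → |ℓ_n(K) − ℓ_n(K')| ≤ lipBar·frameDist K K'` (`…SplitFrameFnMin` l.71) is FALSE
at `n = 0` as typed: the comparison frame `K' = K + ε(h_{L,0} − h_{0,0})` (degree `L`) is admissible and invisible to the model (`K'∘p = K∘p`) while the
scale-`0` piece reads the CONTINUUM frame on its Fermi curve.  So the gen-5 ENGINE decl is false as typed, no skeleton swap can carry the repair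
((R11) FINAL), and K3 is resplit onto this bundle.  THE FROZEN GEN-6 TEXT (J's four-row Δ-table; every other token of `…SplitBundleV14` verbatim):
(T1a) (R-deg) `klFrameDeg N := 2^21·16^N`; `FrameOKDeg R U N μ K := FrameOK R U N μ K ∧ K.degree ≤ klFrameDeg N` (`FrameOK` UNCHANGED);
      `FrameLipschitzFnTD` := the l.71 text with the K′-binder `FrameOK … K'` ↦ `FrameOKDeg … K'` and nothing else; `TwoLegCoreTD hist := TwoLegSizesT1Fn ∧
      FrameLipschitzFnTD hist ∧ TwoLegSlopes`.  The cap depends on `N = nScales β` only (fixed with the frame class, before `L₃ β U` and every volume) and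
      costs the engine NOTHING: `EngineV8.klEngL₃ β U ≤ L ⇒ 2·klFrameDeg (nScales β) < L` for every `U` (`…SplitFrameDegreeGuard`, p2 g9; §3
      `two_mul_klFrameDeg_lt_of_klEngL₃_le`), so inside every engine stub a capped frame — and every capped comparison frame — has `degree ≤ L/2` and is
      reproduced EXACTLY by the symmetrised interpolant of its lattice values (p1b g7 `…SymInterpExact`; §3 `FrameOKDeg.evalM_symInterp_eq`); child 2's
      frames are `0` and Jackson means of degree `d + d ≤ 2^21·16^{nScales β}` (k3c3-p2 `…CountertermDegCapProvider`, cap literal, provider hypothesis-free).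
(T1b) (MS-Q) `msBarQ G Q U n := Q.CE · twoLegBar G Q U 1 n` (`klMsKappa` NOT edited; `Q` is chosen after `R`); `TwoLegSizesMSFnQ` = `…SplitFrameFn`
      l.312 with the ONE token `msBar ↦ msBarQ`; `TwoLegSizesMSTQ` = it at `K.eval`.
(T1c/T1d) `histV15 := BetaSplitAtS2 ∧ RenormalisedAtF ∧ EngineBoundsAtV10S` (= this bundle's `split ∧ renorm ∧ engine`); (E3f-A) `TwoLegVolumeRateA` =
      `TwoLegVolumeRate` (`…SplitBundleV7` l.60–64) with ONE binder block added — the history at EVERY volume `L'' ≥ L` (`Q.M0 β L'' ≤ M''`) below `n`,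
      before the comparison volume (k3c4-p1 g6 l.2059: a general pair `(L, L′)` is reached only through a common multiple; Δ14-class);
      `TwoLegStepV15 := TwoLegCoreTD histV15 ∧ TwoLegSizesMSTQ ∧ TwoLegVolumeRateA (histV15 ∧ TwoLegCoreTD histV15 ∧ TwoLegSizesMSTQ)` (order kept).
(T2)  (R-Dq) `engine := EngineBoundsAtV10S` (k3c2-p3 g3 `…SplitEngineV10`: the four value clauses re-keyed to the profile-free `legDressBarQ2`;
      `engineBoundsAtV10S_of_V9S` lifts every V9S-keyed producer / history).
`klPredsV15 := { frameOK := FrameOKDeg, renorm := RenormalisedAtF, split := BetaSplitAtS2, engine := EngineBoundsAtV10S, twoLeg := TwoLegStepV15 }`.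
CONSEQUENCES (pre-birth sanity HOME/p2-g9/gen6-Rdeg/): child 1 (`betaSplitP_of_slotsV10S (Pr := klPredsV15)`), child 4 (`twoPointAssemblyP3_ex`), glue
(`KLRegimeInductionP4 klPredsV15 …`) close AT BIRTH; child 2 = k3c3-p2's JD chain + degree-cap provider (CountertermV15 body); ENGINE born on `klPredsV15`
with the G5 package (engine stubs keep the raw `FrameOK … K` binder, fed `hK.1`; two-leg stubs bind `FrameOKDeg … K`); VL «cauchy v4» (one stub).
Contents: §1 definitions + `klPredsV15` LITERAL; §2 `rfl` bookkeeping + accessors (V14 names with `V14 ↦ V15`, `CoreT ↦ CoreTD`, `MST ↦ MSTQ`,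
`VolumeRate ↦ VolumeRateA`); §3 bridges (raw ⇒ capped (E3c); (E3f) ⇒ (E3f-A); `histV14 ⇒ histV15`; Nyquist guard + exact reproduction at the engine's
volumes; `frameOKDeg_zero`).  Imports stay OUTSIDE the route file's cone.  Definitions (+ bookkeeping) only; nothing about the model is asserted; no
engine stub is proved here; nothing asserts superconductivity.
-/


noncomputable section

namespace Summit.HubbardSuperconductivity.HubbardSuperconductivity.Theorems.KLRegimeSplit

set_option linter.dupNamespace false -- summit = problem name (single-conjunct summit), D-0017

open Real Finset Literature.MathematicalPhysics.QuantumLattice Literature.Probability.LatticeModels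
open Literature.MathematicalPhysics.QuantumLattice.FermiRG
open Summit.HubbardSuperconductivity.HubbardSuperconductivity.Theorems.KLProgrammeLegKernels

/-! ## §1 (T1a) the degree cap and the capped frame class; (T1b) the `Q.CE`-keyed multi-slot allowance; (T1a/T1c) the capped (E3c), the core step,
the history, the two-leg slot; the bundle -/

/-- **(T1a) the degree cap of admissible frames at depth `N`**: `2^21 · 16^N` (= the cap of child 2's hypothesis-free provider
`selfMapProviderA_degCap_numeral`; dominated by the engine's volume threshold: `klEngL₃ β U ≤ L ⇒ 2·klFrameDeg (nScales β) < L`,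
`…SplitFrameDegreeGuard.two_pow_mul_sixteen_pow_nScales_lt_of_klEngL₃_le`). -/
def klFrameDeg (N : ℕ) : ℕ := 2 ^ 21 * 16 ^ N

/-- **(T1a) `FrameOKDeg R U N μ K`** — an admissible frame (`FrameOK`, UNCHANGED) within the degree cap: `FrameOK R U N μ K ∧ K.degree ≤ klFrameDeg N`.
Same slot type as `Preds.frameOK`. -/
def FrameOKDeg (R : RenConsts) (U : ℝ) (N : ℕ) (μ : ℝ) (K : TrigPolyC4v) : Prop :=
  FrameOK R U N μ K ∧ K.degree ≤ klFrameDeg N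

/-- **(T1b) the `Q.CE`-keyed multi-slot allowance** `msBarQ G Q U n := Q.CE · twoLegBar G Q U 1 n` (replaces the numeral-keyed `msBar = klMsKappa · twoLegBar … 1 n`
in the gen-6 slot; `klMsKappa` itself is NOT edited). -/
def msBarQ (G : GeoConsts) (Q : EngConsts) (U : ℝ) (n : ℕ) : ℝ := Q.CE * twoLegBar G Q U 1 n

section Model

variable (L M : ℕ) [NeZero L] [NeZero M]

/-- **(T1b) (E3a-MS-FnQ)** multi-slot sizes of the scale-`n` function piece — `TwoLegSizesMSFn` (`…SplitFrameFn` l.312) with `msBar ↦ msBarQ`, nothing else: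
`ℓ_n(K) = lp n + Σ_{m ∈ Ioc n (nScales β)} lp m` with symmetric `C⁴` slot functions, the scale-`n` part within `twoLegBar`, the slot-`m` parts within
`msBarQ G Q U n · (Gfr j · uPow j U · 4^{(j-2)m})`. -/
def TwoLegSizesMSFnQ (G : GeoConsts) (Q : EngConsts) (R : RenConsts) (β U μ : ℝ) (K : FrameFn) (n : ℕ) : Prop :=
  ∃ lp : ℕ → FrameFn,
    (∀ p : Fin 2 → ℝ, klTwoLegPieceFn L M β U μ K n p = lp n p + ∑ m ∈ Ioc n (nScales β), lp m p) ∧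
    (∀ m, IsSymmetricFrame (lp m) ∧ ContDiff ℝ 4 (onM (lp m))) ∧
    (∀ j ≤ 4, ∀ q : Momentum, ‖iteratedFDeriv ℝ j (onM (lp n)) q‖ ≤ twoLegBar G Q U j n) ∧
    (∀ m ∈ Ioc n (nScales β), ∀ j ≤ 4, ∀ q : Momentum,
        ‖iteratedFDeriv ℝ j (onM (lp m)) q‖ ≤ msBarQ G Q U n * (R.Gfr j * uPow j U * (4 : ℝ) ^ (((j : ℤ) - 2) * m)))

/-- **(T1b) (E3a-MS-TQ)** the `Q.CE`-keyed multi-slot sizes of the function piece of a `TrigPolyC4v` frame (the FnQ text at `K.eval`; as `TwoLegSizesMST`). -/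
abbrev TwoLegSizesMSTQ (G : GeoConsts) (Q : EngConsts) (R : RenConsts) (β U μ : ℝ) (K : TrigPolyC4v) (n : ℕ) : Prop :=
  TwoLegSizesMSFnQ L M G Q R β U μ K.eval n

/-- **(T1a) (E3c-TD) frame-Lipschitz of the scale-`n` function piece against the CAPPED comparison class** — `FrameLipschitzFnT` (`…SplitFrameFnMin` l.71)
with the `K'`-binder `FrameOK R U (klTempScaleIdx β klE0) μ K'` ↦ `FrameOKDeg R U (klTempScaleIdx β klE0) μ K'` and nothing else. -/
def FrameLipschitzFnTD (hist : TrigPolyC4v → ℕ → Prop) (G : GeoConsts) (Q : EngConsts) (R : RenConsts) (β U μ : ℝ)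
    (K : TrigPolyC4v) (n : ℕ) : Prop :=
  ∀ K' : TrigPolyC4v, FrameOKDeg R U (klTempScaleIdx β klE0) μ K' → (∀ j < n, hist K' j) →
    ∀ q : Fin 2 → ℝ,
      |klTwoLegPieceFn L M β U μ K.eval n q - klTwoLegPieceFn L M β U μ K'.eval n q| ≤ lipBar G Q U n * frameDist K K'

/-- **(T1a) `TwoLegCoreTD hist … K n`** := (E3a-T1) at `K.eval` ∧ (E3c-TD) ∧ (E3d/e) `TwoLegSlopes` — `TwoLegCoreT hist` with the capped (E3c); `P` carried
for slot-shape uniformity. -/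
def TwoLegCoreTD (hist : TrigPolyC4v → ℕ → Prop) (G : GeoConsts) (_P : SplitConsts) (Q : EngConsts) (R : RenConsts)
    (β U μ : ℝ) (K : TrigPolyC4v) (n : ℕ) : Prop :=
  TwoLegSizesT1Fn L M G Q β U μ K.eval n ∧ FrameLipschitzFnTD L M hist G Q R β U μ K n ∧ TwoLegSlopes L M R β U μ K n

/-- **(T1d) (E3f-A) the two-volume rate with the history at EVERY volume from `L` up, before the comparison volume** — `TwoLegVolumeRate`
(`…SplitBundleV7` l.60–64) with ONE binder block added (k3c4-p1 g6's repair of the Δ14-class finding «a general volume pair `(L, L′)` is reached only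
through a common multiple; the V7 antecedent supplies the tower at `L′` only», STATUS l.2059; ADOPTED verbatim as T1d, plan g14 l.2070).  The only
consumer (child 2's volume transfer) discharges the stronger antecedent from a scale-major induction. -/
def TwoLegVolumeRateA (hist : (L' M' : ℕ) → [NeZero L'] → [NeZero M'] → TrigPolyC4v → ℕ → Prop) (Q : EngConsts) (β U μ : ℝ)
    (K : TrigPolyC4v) (n : ℕ) : Prop :=
  Q.M0 β L ≤ M → (∀ (L'' M'' : ℕ) [NeZero L''] [NeZero M''], L ≤ L'' → Q.M0 β L'' ≤ M'' → ∀ j < n, hist L'' M'' K j) →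
    ∀ (L' M' : ℕ) [NeZero L'] [NeZero M'], L ≤ L' → Q.M0 β L' ≤ M' →
      ∀ θ : ℝ, |klLocalPart L M β U μ K n θ - klLocalPart L' M' β U μ K n θ| ≤ Q.CL β n / L

/-- **(T1c) the comparison-frame / comparison-volume history of the V15 bundle** at scale `j`: `BetaSplitAtS2 ∧ RenormalisedAtF ∧ EngineBoundsAtV10S`
(= this bundle's `split ∧ renorm ∧ engine`, so `HistP klPredsV15` discharges it at any volume: `histV15_of_histP_V15`; `histV14 ⇒ histV15`). -/
def histV15 (G : GeoConsts) (P : SplitConsts) (Q : EngConsts) (R : RenConsts) (β U μ : ℝ) : TrigPolyC4v → ℕ → Prop :=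
  fun K' j => BetaSplitAtS2 L M G P Q β U μ K' j ∧ RenormalisedAtF L M β U μ K' R j ∧ EngineBoundsAtV10S L M G P Q β U μ K' j

/-- **(T1c/T1d) `TwoLegStepV15 … G P Q R K n`** := `TwoLegCoreTD histV15 ∧ TwoLegSizesMSTQ ∧ TwoLegVolumeRateA (histV15 ∧ TwoLegCoreTD histV15 ∧
TwoLegSizesMSTQ)` — `TwoLegStepV14` with the (E3c) comparison class capped (in the step AND in the (E3f) antecedent, which child 2 discharges from its
own block), the multi-slot allowance `Q.CE`-keyed, and the (E3f) antecedent quantified over every volume from `L` up (T1d).  Same slot type as `Preds.twoLeg`. -/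
def TwoLegStepV15 (G : GeoConsts) (P : SplitConsts) (Q : EngConsts) (R : RenConsts) (β U μ : ℝ) (K : TrigPolyC4v) (n : ℕ) :
    Prop :=
  TwoLegCoreTD L M (histV15 L M G P Q R β U μ) G P Q R β U μ K n ∧ TwoLegSizesMSTQ L M G Q R β U μ K n ∧
    TwoLegVolumeRateA L M
      (fun L'' M'' _ _ K' j => histV15 L'' M'' G P Q R β U μ K' j ∧
        TwoLegCoreTD L'' M'' (histV15 L'' M'' G P Q R β U μ) G P Q R β U μ K' j ∧ TwoLegSizesMSTQ L'' M'' G Q R β U μ K' j)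
      Q β U μ K n

end Model

/-- **`klPredsV15 : Preds`** — the LITERAL `{ frameOK := FrameOKDeg, renorm := RenormalisedAtF, split := BetaSplitAtS2, engine := EngineBoundsAtV10S,
twoLeg := TwoLegStepV15 }` (= `{ klPredsV14 with frameOK := FrameOKDeg, engine := EngineBoundsAtV10S, twoLeg := TwoLegStepV15 }`, §2 `klPredsV15_eq_with`).  Children of gen 6:
`EngineP4 | BetaSplitP | CountertermP2 | VolumeLimitP2 (FinalTwoLegVolLimitEx) | TwoPointAssemblyP3 (FinalTwoLegVolLimitEx)` on `klPredsV15 klWindowC`. -/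
def klPredsV15 : Preds where
  frameOK := FrameOKDeg
  renorm := fun L M _ _ β U μ K R n => RenormalisedAtF L M β U μ K R n
  split := fun L M _ _ G P Q β U μ K n => BetaSplitAtS2 L M G P Q β U μ K n
  engine := fun L M _ _ G P Q β U μ K n => EngineBoundsAtV10S L M G P Q β U μ K n
  twoLeg := fun L M _ _ G P Q R β U μ K n => TwoLegStepV15 L M G P Q R β U μ K n

/-! ## §2 Bookkeeping (`rfl`-level) and the accessor interface -/

/-- V15 is V14 with the frame class and the two-leg slot replaced (the ruling's spelling). -/
theorem klPredsV15_eq_with : klPredsV15 =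
    { klPredsV14 with
      frameOK := FrameOKDeg
      engine := fun L M _ _ G P Q β U μ K n => EngineBoundsAtV10S L M G P Q β U μ K n
      twoLeg := fun L M _ _ G P Q R β U μ K n => TwoLegStepV15 L M G P Q R β U μ K n } :=
  rfl

/-- The capped class gives the raw one. -/
theorem FrameOKDeg.frameOK {R : RenConsts} {U : ℝ} {N : ℕ} {μ : ℝ} {K : TrigPolyC4v} (h : FrameOKDeg R U N μ K) : FrameOK R U N μ K := h.1

/-- The capped class gives the cap. -/
theorem FrameOKDeg.degree_le {R : RenConsts} {U : ℝ} {N : ℕ} {μ : ℝ} {K : TrigPolyC4v} (h : FrameOKDeg R U N μ K) :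
    K.degree ≤ klFrameDeg N := h.2

/-- The cap, unfolded: `K.degree ≤ 2^21·16^N` (the hypothesis shape of `…SplitFrameDegreeGuard.degree_le_half_of_klEngL₃_le`). -/
theorem FrameOKDeg.degree_le' {R : RenConsts} {U : ℝ} {N : ℕ} {μ : ℝ} {K : TrigPolyC4v} (h : FrameOKDeg R U N μ K) :
    K.degree ≤ 2 ^ 21 * 16 ^ N := h.2

/-- Assembling the capped class. -/
theorem frameOKDeg_of {R : RenConsts} {U : ℝ} {N : ℕ} {μ : ℝ} {K : TrigPolyC4v} (h : FrameOK R U N μ K) (hd : K.degree ≤ klFrameDeg N) :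
    FrameOKDeg R U N μ K := ⟨h, hd⟩

/-- The zero frame is within every cap (`(0 : TrigPolyC4v).degree = 0`). -/
theorem degree_zero_le_klFrameDeg (N : ℕ) : (0 : TrigPolyC4v).degree ≤ klFrameDeg N := Nat.zero_le _

/-- `klPredsV15.frameOK` implies `klPredsV14.frameOK` pointwise (frameOK-antitone transports, `…SplitGenericFrameMono`). -/
theorem klPredsV15_frameOK_imp (R : RenConsts) (U : ℝ) (N : ℕ) (μ : ℝ) (K : TrigPolyC4v) (h : klPredsV15.frameOK R U N μ K) :
    klPredsV14.frameOK R U N μ K := h.1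

/-- V15's frame class is `FrameOKDeg`. -/
theorem klPredsV15_frameOK_apply : klPredsV15.frameOK = FrameOKDeg := rfl

/-- V15's frame class, applied and unfolded to the numeral (child 2's body keys on this shape; it is `Iff.rfl`). -/
theorem klPredsV15_frameOK_iff (R : RenConsts) (U : ℝ) (N : ℕ) (μ : ℝ) (K : TrigPolyC4v) :
    klPredsV15.frameOK R U N μ K ↔ FrameOK R U N μ K ∧ K.degree ≤ 2 ^ 21 * 16 ^ N := Iff.rfl

/-- `FrameOKDeg`, unfolded to the numeral (`Iff.rfl`). -/
theorem frameOKDeg_iff (R : RenConsts) (U : ℝ) (N : ℕ) (μ : ℝ) (K : TrigPolyC4v) :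
    FrameOKDeg R U N μ K ↔ FrameOK R U N μ K ∧ K.degree ≤ 2 ^ 21 * 16 ^ N := Iff.rfl

/-- V15's engine slot, applied: `EngineBoundsAtV10S` (T2). -/
theorem klPredsV15_engine_apply (L M : ℕ) [NeZero L] [NeZero M] (G : GeoConsts) (P : SplitConsts) (Q : EngConsts) (β U μ : ℝ)
    (K : TrigPolyC4v) (n : ℕ) : klPredsV15.engine L M G P Q β U μ K n = EngineBoundsAtV10S L M G P Q β U μ K n := rfl

/-- V15's split slot, applied. -/
theorem klPredsV15_split_apply (L M : ℕ) [NeZero L] [NeZero M] (G : GeoConsts) (P : SplitConsts) (Q : EngConsts) (β U μ : ℝ)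
    (K : TrigPolyC4v) (n : ℕ) : klPredsV15.split L M G P Q β U μ K n = BetaSplitAtS2 L M G P Q β U μ K n := rfl

/-- V15's renormalisation slot, applied. -/
theorem klPredsV15_renorm_apply (L M : ℕ) [NeZero L] [NeZero M] (β U μ : ℝ) (K : TrigPolyC4v) (R : RenConsts) (n : ℕ) :
    klPredsV15.renorm L M β U μ K R n = RenormalisedAtF L M β U μ K R n := rfl

/-- V15's two-leg slot is `TwoLegStepV15`. -/
theorem klPredsV15_twoLeg_apply (L M : ℕ) [NeZero L] [NeZero M] (G : GeoConsts) (P : SplitConsts) (Q : EngConsts) (R : RenConsts)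
    (β U μ : ℝ) (K : TrigPolyC4v) (n : ℕ) :
    klPredsV15.twoLeg L M G P Q R β U μ K n = TwoLegStepV15 L M G P Q R β U μ K n := rfl

/-- The V15 history unfolds to its three slots. -/
theorem histV15_eq (L M : ℕ) [NeZero L] [NeZero M] (G : GeoConsts) (P : SplitConsts) (Q : EngConsts) (R : RenConsts) (β U μ : ℝ)
    (K : TrigPolyC4v) (j : ℕ) :
    histV15 L M G P Q R β U μ K j =
      (BetaSplitAtS2 L M G P Q β U μ K j ∧ RenormalisedAtF L M β U μ K R j ∧ EngineBoundsAtV10S L M G P Q β U μ K j) := rfl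

section Model

variable {L M : ℕ} [NeZero L] [NeZero M] {G : GeoConsts} {P : SplitConsts} {Q : EngConsts} {R : RenConsts} {β U μ : ℝ}
  {K : TrigPolyC4v} {n : ℕ}

/-- `0 ≤ msBarQ` for well-formed constants. -/
theorem msBarQ_nonneg (hG : G.WF) (hQ : Q.WF) (U : ℝ) (n : ℕ) : 0 ≤ msBarQ G Q U n :=
  mul_nonneg hQ.1 (twoLegBar_nonneg' hG hQ U 1 n)

/-- The thin sizes pair of `TwoLegCoreTD` (`C⁴` ∧ tier 1 — what child 2's chain reads). -/
theorem TwoLegCoreTD.sizes {hist : TrigPolyC4v → ℕ → Prop} (h : TwoLegCoreTD L M hist G P Q R β U μ K n) :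
    ContDiff ℝ 4 (onM (klTwoLegPieceFn L M β U μ K.eval n)) ∧
      ∀ j ≤ 2, ∀ q : Momentum, ‖iteratedFDeriv ℝ j (onM (klTwoLegPieceFn L M β U μ K.eval n)) q‖ ≤ twoLegBar G Q U j n := h.1

/-- The named form of the thin sizes pair. -/
theorem TwoLegCoreTD.sizesT1 {hist : TrigPolyC4v → ℕ → Prop} (h : TwoLegCoreTD L M hist G P Q R β U μ K n) :
    TwoLegSizesT1Fn L M G Q β U μ K.eval n := h.1

/-- The function piece is `C⁴` on `Momentum`. -/
theorem TwoLegCoreTD.contDiff {hist : TrigPolyC4v → ℕ → Prop} (h : TwoLegCoreTD L M hist G P Q R β U μ K n) :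
    ContDiff ℝ 4 (onM (klTwoLegPieceFn L M β U μ K.eval n)) := h.1.1

/-- Tier 1 (`j ≤ 2`). -/
theorem TwoLegCoreTD.tier1 {hist : TrigPolyC4v → ℕ → Prop} (h : TwoLegCoreTD L M hist G P Q R β U μ K n) {j : ℕ} (hj : j ≤ 2)
    (q : Momentum) : ‖iteratedFDeriv ℝ j (onM (klTwoLegPieceFn L M β U μ K.eval n)) q‖ ≤ twoLegBar G Q U j n := h.1.2 j hj q

/-- The Lipschitz conjunct (E3c-TD). -/
theorem TwoLegCoreTD.lipschitz {hist : TrigPolyC4v → ℕ → Prop} (h : TwoLegCoreTD L M hist G P Q R β U μ K n) :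
    FrameLipschitzFnTD L M hist G Q R β U μ K n := h.2.1

/-- The slopes conjunct (E3d/e). -/
theorem TwoLegCoreTD.slopes {hist : TrigPolyC4v → ℕ → Prop} (h : TwoLegCoreTD L M hist G P Q R β U μ K n) :
    TwoLegSlopes L M R β U μ K n := h.2.2

/-- The (E3d/e) slopes in the Fn spelling. -/
theorem TwoLegCoreTD.slopesFn {hist : TrigPolyC4v → ℕ → Prop} (h : TwoLegCoreTD L M hist G P Q R β U μ K n) :
    TwoLegSlopesFn L M R β U μ K.eval n := (twoLegSlopesFn_eval_iff L M R β U μ K n).mpr h.2.2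

/-- Assemble a thin step from its three conjuncts. -/
theorem twoLegCoreTD_of_conjuncts {hist : TrigPolyC4v → ℕ → Prop} (hs : TwoLegSizesT1Fn L M G Q β U μ K.eval n)
    (hl : FrameLipschitzFnTD L M hist G Q R β U μ K n) (hsl : TwoLegSlopes L M R β U μ K n) : TwoLegCoreTD L M hist G P Q R β U μ K n :=
  ⟨hs, hl, hsl⟩

/-- The thin two-leg step (capped (E3c), V15 history) is the first conjunct of the V15 slot. -/
theorem twoLegCoreTD_of_twoLegStepV15 (h : TwoLegStepV15 L M G P Q R β U μ K n) :
    TwoLegCoreTD L M (histV15 L M G P Q R β U μ) G P Q R β U μ K n := h.1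

/-- (E3a-MS-TQ) is the second conjunct of the V15 slot. -/
theorem twoLegSizesMSTQ_of_twoLegStepV15 (h : TwoLegStepV15 L M G P Q R β U μ K n) : TwoLegSizesMSTQ L M G Q R β U μ K n := h.2.1

/-- The volume-rate conjunct (E3f-A) with its V15 antecedent (history at every volume from `L` up). -/
theorem twoLegVolumeRateA_of_twoLegStepV15 (h : TwoLegStepV15 L M G P Q R β U μ K n) :
    TwoLegVolumeRateA L M
      (fun L'' M'' _ _ K' j => histV15 L'' M'' G P Q R β U μ K' j ∧
        TwoLegCoreTD L'' M'' (histV15 L'' M'' G P Q R β U μ) G P Q R β U μ K' j ∧ TwoLegSizesMSTQ L'' M'' G Q R β U μ K' j)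
      Q β U μ K n := h.2.2

/-- Assemble the V15 slot from its three conjuncts (the engine's two-leg stubs deliver it in this shape). -/
theorem twoLegStepV15_of_conjuncts (h1 : TwoLegCoreTD L M (histV15 L M G P Q R β U μ) G P Q R β U μ K n)
    (h2 : TwoLegSizesMSTQ L M G Q R β U μ K n)
    (h3 : TwoLegVolumeRateA L M
      (fun L'' M'' _ _ K' j => histV15 L'' M'' G P Q R β U μ K' j ∧
        TwoLegCoreTD L'' M'' (histV15 L'' M'' G P Q R β U μ) G P Q R β U μ K' j ∧ TwoLegSizesMSTQ L'' M'' G Q R β U μ K' j)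
      Q β U μ K n) :
    TwoLegStepV15 L M G P Q R β U μ K n := ⟨h1, h2, h3⟩

/-- **`HistP klPredsV15` below `n` yields the V15 history**: `histV15 … K j` for every `j < n`. -/
theorem histV15_of_histP_V15 (h : HistP klPredsV15 L M G P Q R β U μ K n) : ∀ j < n, histV15 L M G P Q R β U μ K j :=
  fun j hj => ⟨(h j hj).1, (h j hj).2.1, (h j hj).2.2.1⟩

/-- `HistP klPredsV15` below `n` yields the full (E3f) antecedent of V15 at that volume. -/
theorem histRateV15_of_histP (h : HistP klPredsV15 L M G P Q R β U μ K n) :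
    ∀ j < n, histV15 L M G P Q R β U μ K j ∧ TwoLegCoreTD L M (histV15 L M G P Q R β U μ) G P Q R β U μ K j ∧
      TwoLegSizesMSTQ L M G Q R β U μ K j := fun j hj =>
  ⟨⟨(h j hj).1, (h j hj).2.1, (h j hj).2.2.1⟩, (h j hj).2.2.2.1, (h j hj).2.2.2.2.1⟩

/-- **V15's rate clause applies whenever EVERY volume from `L` up (with enough Matsubara modes) carries the V15 history below `n`** — child 2's
one-liner under (E3f-A): its scale-major induction supplies `HistP klPredsV15` at all those volumes. -/
theorem twoLegVolumeRateA_apply_of_V15 (h : TwoLegStepV15 L M G P Q R β U μ K n) (hM : Q.M0 β L ≤ M)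
    (hhistAll : ∀ (L'' M'' : ℕ) [NeZero L''] [NeZero M''], L ≤ L'' → Q.M0 β L'' ≤ M'' → HistP klPredsV15 L'' M'' G P Q R β U μ K n)
    {L' M' : ℕ} [NeZero L'] [NeZero M'] (hL : L ≤ L') (hM' : Q.M0 β L' ≤ M') (θ : ℝ) :
    |klLocalPart L M β U μ K n θ - klLocalPart L' M' β U μ K n θ| ≤ Q.CL β n / L :=
  h.2.2 hM (fun L'' M'' _ _ hL'' hM'' => histRateV15_of_histP (hhistAll L'' M'' hL'' hM'')) L' M' hL hM' θ

/-- Tier-1 sizes of the function piece straight from the V15 slot. -/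
theorem norm_iteratedFDeriv_pieceFn_le_of_V15 (h : TwoLegStepV15 L M G P Q R β U μ K n) {j : ℕ} (hj : j ≤ 2) (q : Momentum) :
    ‖iteratedFDeriv ℝ j (onM (klTwoLegPieceFn L M β U μ K.eval n)) q‖ ≤ twoLegBar G Q U j n :=
  h.1.tier1 hj q

/-- (E2-v10) straight from the V15 history at `j` (k3c2-p3's named projection). -/
theorem pairLadderStepAtV10_of_histV15 {j : ℕ} (h : histV15 L M G P Q R β U μ K j) : PairLadderStepAtV10 L M G P Q β U μ K j :=
  pairLadderStepAtV10_of_engineBoundsAtV10S h.2.2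

/-- The engine slot of the V15 history at `j`. -/
theorem engineBoundsAtV10S_of_histV15 {j : ℕ} (h : histV15 L M G P Q R β U μ K j) : EngineBoundsAtV10S L M G P Q β U μ K j := h.2.2

/-- The split slot of the V15 history at `j`. -/
theorem betaSplitAtS2_of_histV15 {j : ℕ} (h : histV15 L M G P Q R β U μ K j) : BetaSplitAtS2 L M G P Q β U μ K j := h.1

/-- The renormalisation slot of the V15 history at `j`. -/
theorem renormalisedAtF_of_histV15 {j : ℕ} (h : histV15 L M G P Q R β U μ K j) : RenormalisedAtF L M β U μ K R j := h.2.1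

/-- `HistP klPredsV15` at `j < n`, destructured into the four slots by `rfl`. -/
theorem histP_V15_apply (h : HistP klPredsV15 L M G P Q R β U μ K n) {j : ℕ} (hj : j < n) :
    BetaSplitAtS2 L M G P Q β U μ K j ∧ RenormalisedAtF L M β U μ K R j ∧ EngineBoundsAtV10S L M G P Q β U μ K j ∧
      TwoLegStepV15 L M G P Q R β U μ K j := h j hj

end Model

/-! ## §3 Bridges: raw-class (E3c-T) ⇒ capped (E3c-TD); (E3c-TD) antitone in the history; V14 core ⇒ V15 core; the cap at the slot's own depth -/

section Bridge

variable {L M : ℕ} [NeZero L] [NeZero M] {G : GeoConsts} {P : SplitConsts} {Q : EngConsts} {R : RenConsts} {β U μ : ℝ}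
  {K : TrigPolyC4v} {n : ℕ}

/-- **A V14 history is a V15 history** (for `P.WF`, `Q.WF`): `engineBoundsAtV10S_of_V9S` on the engine conjunct. -/
theorem histV15_of_histV14 (hP : P.WF) (hQ : Q.WF) {j : ℕ} (h : histV14 L M G P Q R β U μ K j) : histV15 L M G P Q R β U μ K j :=
  ⟨h.1, h.2.1, engineBoundsAtV10S_of_V9S hP hQ h.2.2⟩

/-- **At scale `0` the V15 and V14 histories COINCIDE** (the re-keyed leg-dressing budgets agree at `n = 0`). -/
theorem histV15_iff_histV14_zero : histV15 L M G P Q R β U μ K 0 ↔ histV14 L M G P Q R β U μ K 0 := by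
  simp only [histV15, histV14, engineBoundsAtV10S_iff_V9S_zero]

/-- **Today's (E3c-T) (comparison class `FrameOK`) implies the capped (E3c-TD)** (fewer comparison frames), same history. -/
theorem frameLipschitzFnTD_of_T {hist : TrigPolyC4v → ℕ → Prop} (h : FrameLipschitzFnT L M hist G Q R β U μ K n) :
    FrameLipschitzFnTD L M hist G Q R β U μ K n :=
  fun K' hK' hh q => h K' hK'.1 hh q

/-- **(E3c-TD) is ANTITONE in the history token.** -/
theorem frameLipschitzFnTD_anti {hist₁ hist₂ : TrigPolyC4v → ℕ → Prop} (hh : ∀ K' j, hist₁ K' j → hist₂ K' j)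
    (h : FrameLipschitzFnTD L M hist₂ G Q R β U μ K n) : FrameLipschitzFnTD L M hist₁ G Q R β U μ K n :=
  fun K' hK' hh' q => h K' hK' (fun j hj => hh K' j (hh' j hj)) q

/-- The capped core step is antitone in the history token (through (E3c-TD)). -/
theorem twoLegCoreTD_anti {hist₁ hist₂ : TrigPolyC4v → ℕ → Prop} (hh : ∀ K' j, hist₁ K' j → hist₂ K' j)
    (h : TwoLegCoreTD L M hist₂ G P Q R β U μ K n) : TwoLegCoreTD L M hist₁ G P Q R β U μ K n :=
  ⟨h.1, frameLipschitzFnTD_anti hh h.2.1, h.2.2⟩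

/-- **Today's thin step `TwoLegCoreT hist` implies the capped `TwoLegCoreTD hist`.** -/
theorem twoLegCoreTD_of_coreT {hist : TrigPolyC4v → ℕ → Prop} (h : TwoLegCoreT L M hist G P Q R β U μ K n) :
    TwoLegCoreTD L M hist G P Q R β U μ K n :=
  ⟨h.1, frameLipschitzFnTD_of_T h.2.1, h.2.2⟩

/-- **The V15 core step implies the V14-history core step over the capped class** (for `P.WF`, `Q.WF`): V15's (E3c) ranges over MORE comparison
frames (weaker history requirement `histV15 ⇐ histV14`). -/
theorem twoLegCoreTD_histV14_of_histV15 (hP : P.WF) (hQ : Q.WF)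
    (h : TwoLegCoreTD L M (histV15 L M G P Q R β U μ) G P Q R β U μ K n) :
    TwoLegCoreTD L M (histV14 L M G P Q R β U μ) G P Q R β U μ K n :=
  twoLegCoreTD_anti (fun _ _ hK' => histV15_of_histV14 hP hQ hK') h

/-- **(E3f) ⇒ (E3f-A)**: the V7-shaped rate clause (history asked at the comparison volume only) implies the (E3f-A) clause (history asked at every
volume from `L` up) — the antecedent only got stronger; so every `TwoLegVolumeRate`-keyed producer composes with one line. -/
theorem twoLegVolumeRateA_of_twoLegVolumeRate {hist : (L' M' : ℕ) → [NeZero L'] → [NeZero M'] → TrigPolyC4v → ℕ → Prop}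
    (h : TwoLegVolumeRate L M hist Q β U μ K n) : TwoLegVolumeRateA L M hist Q β U μ K n :=
  fun hM hall L' M' _ _ hL hM' θ => h hM L' M' hL hM' (hall L' M' hL hM') θ

/-- A comparison frame of the capped (E3c) at the slot's depth carries the cap in the `…SplitFrameDegreeGuard` shape. -/
theorem FrameOKDeg.degree_le_nScales {K' : TrigPolyC4v} (h : FrameOKDeg R U (klTempScaleIdx β klE0) μ K') :
    K'.degree ≤ 2 ^ 21 * 16 ^ nScales β := h.2

/-- **(R6-3) the bare frame is in the capped class wherever it is admissible** (`degree 0 = 0 ≤ cap`); the unconditional covariance-window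
instance `frameOKDeg_zeroC` (from `klFrameOK_zeroC`, which lives in the route-dependent `…SplitGlue`) is stated in `…SplitGlueV15P4Ex` so that this
bundle stays OUTSIDE the route file's import cone (the route file imports the bundle at the gen-6 resplit). -/
theorem frameOKDeg_zero {N : ℕ} (h : FrameOK R U N μ (0 : TrigPolyC4v)) : FrameOKDeg R U N μ 0 := ⟨h, degree_zero_le_klFrameDeg N⟩

/-- **(R6-2) the Nyquist guard at the engine's volumes**: `klEngL₃ β U ≤ L ⇒ 2·klFrameDeg (nScales β) < L` for every `U` and `β ≥ klBetaMin`
(`…SplitFrameDegreeGuard.two_pow_mul_sixteen_pow_nScales_lt_of_klEngL₃_le`: `2^22·16^{n_β} ≤ 4096β²/π² < 1024β² ≤ klEngL₃ β U`). -/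
theorem two_mul_klFrameDeg_lt_of_klEngL₃_le (hβ : klBetaMin ≤ β) {L : ℕ} (hL : EngineV8.klEngL₃ β U ≤ L) :
    2 * klFrameDeg (nScales β) < L := by
  have h := two_pow_mul_sixteen_pow_nScales_lt_of_klEngL₃_le (U := U) hβ hL
  have e : 2 * klFrameDeg (nScales β) = 2 ^ 22 * 16 ^ nScales β := by unfold klFrameDeg; ring
  rw [e]; exact h

/-- **Hence every frame of the capped class has `degree ≤ L/2` at every engine volume** (the hypothesis of p1b's `…SymInterpExact` reproduction
lemmas `eval(M)_symInterp_latticeValues_of_degree_le`; with `bandLimited_of_degree_le` it is band-limited at `L`). -/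
theorem FrameOKDeg.degree_le_half {N : ℕ} (hK : FrameOKDeg R U N μ K) (hN : N = nScales β) (hβ : klBetaMin ≤ β) {L : ℕ}
    (hL : EngineV8.klEngL₃ β U ≤ L) : K.degree ≤ L / 2 := by
  subst hN
  exact degree_le_half_of_klEngL₃_le hβ hL hK.2

/-- **… and is reproduced EXACTLY by the symmetrised interpolant of its lattice values there** (p1b's lemma by name, via `…SplitFrameDegreeGuard`). -/
theorem FrameOKDeg.evalM_symInterp_eq (hK : FrameOKDeg R U (nScales β) μ K) (hβ : klBetaMin ≤ β) (L : ℕ) [NeZero L]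
    (hL : EngineV8.klEngL₃ β U ≤ L) : evalM (symInterp L (fun k => K.eval (latticeMomentum L k))) = evalM K :=
  evalM_symInterp_latticeValues_of_klEngL₃_le hβ L hL hK.2

end Bridge

end Summit.HubbardSuperconductivity.HubbardSuperconductivity.Theorems.KLRegimeSplit

end
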